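import Literature.AlgebraicGeometry.Modules.CechSheafHomExchange
import Literature.AlgebraicGeometry.HodgeTheory.AtiyahClassTraceReal
import HarnessLib

/-!
# Traces of Čech `Ext`-classes: `Tr(θ(ω)) = θ(tr ω)`

Let `E` be a finite locally free `𝒪_X`-module, `𝓤` an open cover of the scheme `X`, `M`, `N`
`𝒪_X`-modules and `t : 𝓗om(E, M) → N` a morphism. For a cocycle of local homomorphisms
`ω = (ω_α : E|_{U_α} → M|_{U_α})` with Čech `Ext`-class `[ω] = θ(ω♯) ∈ Extⁿ(E, M)`
(`Modules/CechTheta.lean`) we prove the **push-forward formula**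

  `[𝒪 → 𝓔nd E] ∘ 𝓗om(E, [ω]) ∘ [t] = [t_* ω] ∈ Extⁿ(𝒪_X, N)`   (`Cech.theta_sheafHom_push`),

where `t_* ω = (r ↦ r • t(ω_α))_α` (`Cech.pushFamily`): apply the exact functor `𝓗om(E, –)`
(`theta_mapFunctor`), precompose with the unit (`theta_comp_left`), and push along the
exchange–evaluation chain map `κ_t : 𝓗om(E, Č•(𝓤, M)) → Č•(𝓤, N)` (`theta_comp_map`,
`Modules/CechSheafHomExchange.lean`). Specialisations:

* `Cech.traceExt_classOf` — **`Tr[ω] = [tr ω]`**: the trace `Tr : Extⁿ(E, E) → Extⁿ(𝒪, 𝒪)` of the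
  tree's `HodgeTheory/AtiyahClassTraceReal.lean` (`traceExt`, i.e. `σ₀` before passing to sheaf
  cohomology) of the class of a Čech cocycle of local ENDOMORPHISMS is the class of the scalar
  cocycle of its local traces (`t = trace`);
* `Cech.traceExtCoeff_classOf` — the same for the trace with coefficients
  `Tr_G : Extⁿ(E, 𝓗om(E^∨, G)) → Extⁿ(𝒪, G)` (`t = contract`), the map behind `σ₁`.

This is the cochain-level description of Illusie's / Buchweitz–Flenner's trace on `Ext` used to
prove additivity of `σ_q ∘ ob` over short exact sequences (block-triangular cocycles have
block-diagonal traces). Everything is proved; no named facts.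

## References

* R.-O. Buchweitz, H. Flenner, *A semiregularity map for modules and applications to deformations*,
  Compositio Math. 137 (2003), §4. [BuchweitzFlenner2003]
* R. Hartshorne, *Algebraic Geometry*, GTM 52 (1977), III.4, III.6.7. [Hartshorne1977]
-/

noncomputable section

universe u

open CategoryTheory CategoryTheory.Abelian AlgebraicGeometry Opposite TopologicalSpace Limits

namespace Literature.AlgebraicGeometry.Modules

open Literature.AlgebraicGeometry.Motives Literature.AlgebraicGeometry.HodgeTheory
  Literature.Algebra.Homology

namespace Cech

variable {X : Scheme.{u}} {ι : Type u} {U : ι → X.Opens} (hU : iSup U = ⊤) {n : ℕ} {E M N : X.Modules}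
  (t : sheafHom E M ⟶ N)

/-- **The pushed-forward cochain of a cocycle is a cocycle** (indeed `(t_* ω)♯` factors through
`ω♯`: `unit ≫ 𝓗om(E, ω♯) ≫ κ_t`). [folklore] -/
theorem dFamily_pushFamily (ω : LocalFamily U n E M) (hω : dFamily ω = 0) :
    dFamily (pushFamily t ω) = 0 := by
  apply familyHom_injective
  have hd : familyHom ω ≫ d U M n = 0 := by rw [familyHom_comp_d, hω, familyHom_zero]
  have h0 : sheafHomMap E (0 : E ⟶ obj U (n + 1) M) = 0 := (sheafHomFunctor E).map_zero _ _
  rw [familyHom_zero, ← familyHom_comp_d, ← sheafHomUnit_familyHom_exchange, Category.assoc,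
    Category.assoc, exchange_comp_d, ← Category.assoc (sheafHomMap E (familyHom ω)), ← sheafHomMap_comp,
    hd, h0, zero_comp, comp_zero]

variable [HasExt.{u + 1} X.Modules] (hE : IsFiniteLocallyFree E)

/-- **The push-forward formula for Čech `Ext`-classes**: for `t : 𝓗om(E, M) → N` and a cocycle `ω`
of local homomorphisms `E → M` on the cover `𝓤`,
`[unit] ∘ 𝓗om(E, [ω]) ∘ [t] = [t_* ω] ∈ Extⁿ(𝒪_X, N)`. [cite: BuchweitzFlenner2003, §4 (trace map)] -/
theorem theta_sheafHom_push (ω : LocalFamily U n E M) (hω : dFamily ω = 0) :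
    haveI := preservesFiniteColimits_sheafHomFunctor E hE
    (Ext.mk₀ (sheafHomUnit E)).comp
        (((classOf (exactAugmentation U M hU) ω hω).mapExactFunctor (sheafHomFunctor E)).comp
          (Ext.mk₀ t) (add_zero n)) (zero_add n) =
      classOf (exactAugmentation U N hU) (pushFamily t ω) (dFamily_pushFamily t ω hω) := by
  haveI := preservesFiniteColimits_sheafHomFunctor E hE
  -- the cocycle conditions along the way
  have hωK : familyHom ω ≫ (complex U M).d n (n + 1) = 0 := familyHom_comp_d_eq_zero ω hω
  have hΦ : (sheafHomFunctor E).map (familyHom ω) ≫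
      (ExactAugmentation.mapK (sheafHomFunctor E) (complex U M)).d n (n + 1) = 0 :=
    ExactAugmentation.map_d_eq_zero (K := complex U M) (sheafHomFunctor E) (familyHom ω) hωK
  have hu : (sheafHomUnit E ≫ (sheafHomFunctor E).map (familyHom ω)) ≫
      (ExactAugmentation.mapK (sheafHomFunctor E) (complex U M)).d n (n + 1) = 0 :=
    (Category.assoc _ _ _).trans ((congrArg (sheafHomUnit E ≫ ·) hΦ).trans comp_zero)
  have hκ : ((sheafHomUnit E ≫ (sheafHomFunctor E).map (familyHom ω)) ≫ (exchangeChainMap U M t).f n) ≫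
      (complex U N).d n (n + 1) = 0 :=
    ExactAugmentation.comp_f_d_eq_zero (exchangeChainMap U M t) _ hu
  -- compatibility of `κ_t` with the augmentations, and the key identity
  have hμ : ((exactAugmentation U M hU).mapFunctor (sheafHomFunctor E)).ε ≫ (exchangeChainMap U M t).f 0 =
      t ≫ (exactAugmentation U N hU).ε := exchange_augment t
  have hK3 : (sheafHomUnit E ≫ (sheafHomFunctor E).map (familyHom ω)) ≫ (exchangeChainMap U M t).f n =
      familyHom (pushFamily t ω) :=
    (Category.assoc _ _ _).trans (sheafHomUnit_familyHom_exchange t ω)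
  -- the five moves, as equalities of `Ext`-classes
  have e1 : (classOf (exactAugmentation U M hU) ω hω).mapExactFunctor (sheafHomFunctor E) =
      ((exactAugmentation U M hU).mapFunctor (sheafHomFunctor E)).theta
        ((sheafHomFunctor E).map (familyHom ω)) hΦ :=
    (ExactAugmentation.theta_mapFunctor (sheafHomFunctor E) (exactAugmentation U M hU) (familyHom ω) hωK hΦ).symm
  have e2 : (Ext.mk₀ (sheafHomUnit E)).comp ((((exactAugmentation U M hU).mapFunctor (sheafHomFunctor E)).theta
        ((sheafHomFunctor E).map (familyHom ω)) hΦ).comp (Ext.mk₀ t) (add_zero n)) (zero_add n) =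
      ((Ext.mk₀ (sheafHomUnit E)).comp (((exactAugmentation U M hU).mapFunctor (sheafHomFunctor E)).theta
        ((sheafHomFunctor E).map (familyHom ω)) hΦ) (zero_add n)).comp (Ext.mk₀ t) (add_zero n) :=
    (Ext.comp_assoc_of_third_deg_zero _ _ _ _).symm
  have e3 : (Ext.mk₀ (sheafHomUnit E)).comp (((exactAugmentation U M hU).mapFunctor (sheafHomFunctor E)).theta
        ((sheafHomFunctor E).map (familyHom ω)) hΦ) (zero_add n) =
      ((exactAugmentation U M hU).mapFunctor (sheafHomFunctor E)).theta
        (sheafHomUnit E ≫ (sheafHomFunctor E).map (familyHom ω)) hu :=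
    (ExactAugmentation.theta_comp_left ((exactAugmentation U M hU).mapFunctor (sheafHomFunctor E))
      (sheafHomUnit E) ((sheafHomFunctor E).map (familyHom ω)) hΦ).symm
  have e4 : (((exactAugmentation U M hU).mapFunctor (sheafHomFunctor E)).theta
        (sheafHomUnit E ≫ (sheafHomFunctor E).map (familyHom ω)) hu).comp (Ext.mk₀ t) (add_zero n) =
      (exactAugmentation U N hU).theta
        ((sheafHomUnit E ≫ (sheafHomFunctor E).map (familyHom ω)) ≫ (exchangeChainMap U M t).f n) hκ :=
    (ExactAugmentation.theta_comp_map ((exactAugmentation U M hU).mapFunctor (sheafHomFunctor E))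
      (exactAugmentation U N hU) (exchangeChainMap U M t) t hμ _ hu hκ).symm
  have e5 : (exactAugmentation U N hU).theta
        ((sheafHomUnit E ≫ (sheafHomFunctor E).map (familyHom ω)) ≫ (exchangeChainMap U M t).f n) hκ =
      classOf (exactAugmentation U N hU) (pushFamily t ω) (dFamily_pushFamily t ω hω) :=
    (exactAugmentation U N hU).theta_congr hK3 _ _
  rw [e1, e2, e3, e4, e5]

/-- **`Tr[ω] = [tr ω]`**: the trace on `Ext` (`HodgeTheory.traceExt`, `= σ₀` before passing to
sheaf cohomology) of the class of a Čech cocycle of local endomorphisms of a finite locally free `E`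
is the class of the scalar cocycle `(r ↦ r • tr(ω_α))_α`. [cite: BuchweitzFlenner2003, §4 (trace map)] -/
theorem traceExt_classOf (ω : LocalFamily U n E E) (hω : dFamily ω = 0) :
    traceExt hE n (classOf (exactAugmentation U E hU) ω hω) =
      classOf (exactAugmentation U (unitModule X) hU) (pushFamily (trace hE) ω)
        (dFamily_pushFamily (trace hE) ω hω) := by
  rw [traceExt_apply]
  exact theta_sheafHom_push hU (trace hE) hE ω hω

/-- **`Tr_G[c] = [tr_G c]`**: the trace with coefficients `G` on `Ext` (`HodgeTheory.traceExtCoeff`)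
of the class of a Čech cocycle of local homomorphisms `E → 𝓗om(E^∨, G) (≅ E ⊗ G)` is the class of
the cocycle of its local contractions. [cite: BuchweitzFlenner2003, §4 (trace map)] -/
theorem traceExtCoeff_classOf (G : X.Modules) (c : LocalFamily U n E (sheafHom (dual E) G))
    (hc : dFamily c = 0) :
    traceExtCoeff hE G n (classOf (exactAugmentation U (sheafHom (dual E) G) hU) c hc) =
      classOf (exactAugmentation U G hU) (pushFamily (contract hE G) c)
        (dFamily_pushFamily (contract hE G) c hc) := by
  rw [traceExtCoeff_apply]
  exact theta_sheafHom_push hU (contract hE G) hE c hc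


/-! ### Additivity of traces of classes from additivity of the local traces

The form in which `σ₀(ob F₂) = σ₀(ob F₁) + σ₀(ob F₃)` (and the `σ₁` analogue) is obtained from a
cochain-level identity of local traces on a common cover (block upper triangular cocycles,
`Deformation/AdaptedObstructionTrace.lean`). -/

section Additivity

omit [HasExt.{u + 1} X.Modules] in
/-- Two sections agreeing after restriction along `W' ≤ W` with also `W ≤ W'` are equal (used with
`W' = V ⊓ W`, `V ⊇ W`, to compare local traces given over `V ⊓ U_α`). [folklore] -/
lemma sections_eq_of_res_eq {N' : X.Modules} {W W' : X.Opens} (h : W' ≤ W) (h' : W ≤ W')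
    {s s' : Γ(N', W)} (e : res N' h s = res N' h s') : s = s' := by
  have h2 := congrArg (res N' h') e
  rwa [res_res, res_res, res_self, res_self] at h2

omit [HasExt.{u + 1} X.Modules] in
/-- **The pushed-forward cochains only see the local values `t(ω_α)`**: if
`t₂(ω²_α) = t₁(ω¹_α) + t₃(ω³_α)` for all simplices `α`, then `t₂_* ω² = t₁_* ω¹ + t₃_* ω³`. [folklore] -/
theorem pushFamily_eq_add {E₁ E₂ E₃ M₁ M₂ M₃ N' : X.Modules} (t₁ : sheafHom E₁ M₁ ⟶ N')
    (t₂ : sheafHom E₂ M₂ ⟶ N') (t₃ : sheafHom E₃ M₃ ⟶ N') (ω₁ : LocalFamily U n E₁ M₁)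
    (ω₂ : LocalFamily U n E₂ M₂) (ω₃ : LocalFamily U n E₃ M₃)
    (h : ∀ α, t₂.app (face U α) (ω₂ α) = t₁.app (face U α) (ω₁ α) + t₃.app (face U α) (ω₃ α)) :
    pushFamily t₂ ω₂ = pushFamily t₁ ω₁ + pushFamily t₃ ω₃ := by
  funext α
  change smulSection _ = smulSection _ + smulSection _
  rw [h α]
  exact hom_ext_of_appLE fun W k r => by
    rw [appLE_add, appLE_smulSection, appLE_smulSection, appLE_smulSection, map_add, smul_add]

/-- **Additivity of `Tr[ω]` from additivity of the local traces**: for cocycles of local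
endomorphisms `ωᵏ` of finite locally free `E_k` (`k = 1, 2, 3`) on the same cover with
`tr(ω²_α) = tr(ω¹_α) + tr(ω³_α)` for all `α`, `Tr[ω²] = Tr[ω¹] + Tr[ω³]` in `Extⁿ(𝒪, 𝒪)`.
[cite: BuchweitzFlenner2003, Prop. 4.2] -/
theorem traceExt_classOf_eq_add {E₁ E₂ E₃ : X.Modules} (hE₁ : IsFiniteLocallyFree E₁)
    (hE₂ : IsFiniteLocallyFree E₂) (hE₃ : IsFiniteLocallyFree E₃) (ω₁ : LocalFamily U n E₁ E₁)
    (ω₂ : LocalFamily U n E₂ E₂) (ω₃ : LocalFamily U n E₃ E₃) (hω₁ : dFamily ω₁ = 0)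
    (hω₂ : dFamily ω₂ = 0) (hω₃ : dFamily ω₃ = 0)
    (h : ∀ α, (trace hE₂).app (face U α) (ω₂ α) =
      (trace hE₁).app (face U α) (ω₁ α) + (trace hE₃).app (face U α) (ω₃ α)) :
    traceExt hE₂ n (classOf (exactAugmentation U E₂ hU) ω₂ hω₂) =
      traceExt hE₁ n (classOf (exactAugmentation U E₁ hU) ω₁ hω₁) +
        traceExt hE₃ n (classOf (exactAugmentation U E₃ hU) ω₃ hω₃) := by
  rw [traceExt_classOf, traceExt_classOf, traceExt_classOf, ← classOf_add]
  exact classOf_congr _ (pushFamily_eq_add _ _ _ _ _ _ h) _ _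

/-- **Additivity of `Tr_G[c]` from additivity of the local contractions** (the `σ₁`-type version,
coefficients `G`). [cite: BuchweitzFlenner2003, Prop. 4.2] -/
theorem traceExtCoeff_classOf_eq_add (G : X.Modules) {E₁ E₂ E₃ : X.Modules}
    (hE₁ : IsFiniteLocallyFree E₁) (hE₂ : IsFiniteLocallyFree E₂) (hE₃ : IsFiniteLocallyFree E₃)
    (c₁ : LocalFamily U n E₁ (sheafHom (dual E₁) G)) (c₂ : LocalFamily U n E₂ (sheafHom (dual E₂) G))
    (c₃ : LocalFamily U n E₃ (sheafHom (dual E₃) G)) (hc₁ : dFamily c₁ = 0) (hc₂ : dFamily c₂ = 0)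
    (hc₃ : dFamily c₃ = 0)
    (h : ∀ α, (contract hE₂ G).app (face U α) (c₂ α) =
      (contract hE₁ G).app (face U α) (c₁ α) + (contract hE₃ G).app (face U α) (c₃ α)) :
    traceExtCoeff hE₂ G n (classOf (exactAugmentation U (sheafHom (dual E₂) G) hU) c₂ hc₂) =
      traceExtCoeff hE₁ G n (classOf (exactAugmentation U (sheafHom (dual E₁) G) hU) c₁ hc₁) +
        traceExtCoeff hE₃ G n (classOf (exactAugmentation U (sheafHom (dual E₃) G) hU) c₃ hc₃) := by
  rw [traceExtCoeff_classOf, traceExtCoeff_classOf, traceExtCoeff_classOf, ← classOf_add]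
  exact classOf_congr _ (pushFamily_eq_add _ _ _ _ _ _ h) _ _

end Additivity

end Cech

end Literature.AlgebraicGeometry.Modules

end
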